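import Literature.NumberTheory.Automorphic.ShimuraParametrizationSplitDegreeProofs
import Literature.NumberTheory.Automorphic.ShimuraCurveDataExistence
import Literature.NumberTheory.EllipticCurves.LFunctionSmulProofs
import HarnessLib

/-!
# The converse transport at `D = 1`: a Shimura-curve parametrisation on `Γ₀^1(N)` IS an analytic
# modular parametrisation by `Y₀(N)`; `nonempty_shimuraParametrizationData` implies the
# (almost-everywhere) modularity of every elliptic curve over `ℚ`

Topic `NumberTheory/Automorphic`; theorems only (no definition, no named fact, no instance; D-0026).
A companion of `ShimuraParametrizationSplitCaseProofs` (which transports the newform of `W` FROM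
`X₀(M)` TO an arbitrary presentation `Γ₀^1(M) = ι(O¹)` of level `(1, M)`). This file runs the
transport in the OPPOSITE direction, for ARBITRARY eigen-data (no newform, no `q`-expansion), and
records what the named fact
`Literature.NumberTheory.Automorphic.nonempty_shimuraParametrizationData`
(`ShimuraCurveRibetTakahashi.lean`; H. Pasten, *Shimura curves and the abc conjecture*,
J. Number Theory 254 (2024) = arXiv:1705.09251, §2 p. 12: "for each admissible factorization
`N = DM`, the Jacquet–Langlands correspondence gives an optimal quotient `q_{D,M} : J₀^D(M) → A_{D,M}`
… with `A_{D,M}` isogenous to `E`"; for `D = 1`, "the Eichler–Shimura construction gives an optimal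
quotient `q_{1,N} : J₀(N) → A_{1,N}`", `X₀^1(N) = X₀(N)`) IMPLIES — a lower bound complementing the
tree's reductions of the fact to the Modularity theorem (`exists_isNewformOf`) plus, for `D > 1`,
Jacquet–Langlands and Shimura's construction
(`nonempty_shimuraParametrizationData_of_exists_isNewformOf`,
`…_of_exists_isNewformOf_of_transfer_of_shimuraConstruction`):

1. `segmentIntegral_slash_eq`, `hasPeriodsIn_slash` — for `g ∈ GL₂(ℝ)` of positive determinant
   and a weight-`2` form `F` on any `Γ ≤ GL₂(ℝ)`, `∫_z^w (F ∣[2] g) = ∫_{gz}^{gw} F` (chain rule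
   `d(gτ)/dτ = det g / j(g, τ)²` against a holomorphic primitive of `F` on `ℍ`), so the periods of
   `F ∣[2] g` on `g⁻¹ Γ g` are periods of `F` on `Γ`.
2. `ShimuraCurveData.heckeFun_eq_smul_heckeT_slash` — the UNCONDITIONAL Hecke identity behind
   the tree's `heckeFun_eq_mul_of_conj` and `coe_heckeT_eq_smul_of_heckeFun_eq`
   (`ShimuraParametrizationSplitDegreeProofs`, reused below together with its
   `exists_cuspForm_gamma0_coe_eq_slash`): if `Γ₀^1(M) = h Γ₀(M) h⁻¹` (`det h > 0`,
   `exists_conj_of_discr_one`) and `F = C · (f ∣[2] h⁻¹)` then `X.heckeFun ℓ F = C · (T_ℓ f) ∣[2] h⁻¹`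
   for primes `ℓ ∤ M` (both sides are sums over the `ℓ + 1` cosets `h βᵢ h⁻¹`, resp. `βᵢ`;
   Diamond–Shurman Prop. 5.2.1); `finite_setOf_card_orbitFibre_gamma0_ne` — fibre counts of
   `Γτ ↦ ∫_{τ₀}^τ F` read on `Y₀(M)` for an ARBITRARY form `F` (segment integrals, no `q`-expansion).
3. `classicalHalf_of_automorphicHalf_one` / `automorphicHalf_one_of_classicalHalf` /
   `exists_automorphicHalf_one_iff_classicalHalf` — at `D = 1` the automorphic half of the fact on
   `X.Gamma` (a non-zero weight-`2` form with periods in `Λ`, `T_ℓ`-eigen away from `M`, with a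
   cofinite fibre count for `Γτ ↦ ∫_{τ₀}^τ (mod Λ)`) is EQUIVALENT to the same statement on
   `Γ₀(M)` with the classical `T_ℓ` (tree `heckeT`) and the orbit space `Y₀(M)`.
4. `classicalHalf_of_nonempty_shimuraParametrizationData` — the fact implies: every globally
   minimal elliptic `W/ℚ` of conductor `N` has `f ≠ 0` in `S₂(Γ₀(N))` with `T_ℓ f = a_ℓ(W) f` for
   all primes `ℓ ∤ N`, periods in the Néron lattice `Λ_W`, and a degree `d ≥ 1` such that all but
   finitely many classes of `ℂ/Λ_W ≅ W(ℂ)` have exactly `d` preimage orbits in `Y₀(N)` under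
   `τ ↦ ∫_{τ₀}^τ f` — an analytic modular parametrisation `Y₀(N) → W(ℂ)`;
   `exists_heckeEigenform_of_nonempty_shimuraParametrizationData` — every elliptic curve over `ℚ`
   is almost-everywhere modular (a non-zero `T_ℓ`-eigenform of level `N_W` with eigenvalues
   `a_ℓ(W)`, `ℓ ∤ N_W`).
5. `nonempty_shimuraParametrizationData_iff_classicalHalf_and_eigenform` — the fact is
   EQUIVALENT to the conjunction of that classical statement (all globally minimal elliptic `W/ℚ`)
   and, for `D > 1`, the existence of a non-zero Jacquet–Langlands `T_ℓ`-eigenform on `Γ₀^D(M)`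
   with periods in `Λ_W` (the hypothesis `hJL` of
   `nonempty_shimuraParametrizationData_of_exists_isNewformOf`);
   `nonempty_shimuraParametrizationData_iff_eigenform_of_exists_isNewformOf` — modulo the
   Modularity theorem (`exists_isNewformOf`) the fact is EXACTLY that `D > 1` statement.

So the fact sits between "a.e.-modularity of every `E/ℚ`" (this file) and "Modularity
(`exists_isNewformOf`) ∧ Jacquet–Langlands ∧ Shimura's construction" (the reductions): it is an
apex of the tree of the size of the Modularity theorem, not an artefact of its phrasing.

## References

* H. Pasten, *Shimura curves and the abc conjecture*, J. Number Theory 254 (2024) 214–335 =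
  arXiv:1705.09251, §2 p. 12, §4.8 p. 15, §5.3 p. 17. [PastenShimura2024]
* F. Diamond, J. Shurman, *A First Course in Modular Forms*, GTM 228, Prop. 5.2.1, Ex. 5.1.3.
  [DiamondShurman2005]
* C. Breuil, B. Conrad, F. Diamond, R. Taylor, JAMS 14 (2001), Thm. A (the statement implied).
  [BreuilConradDiamondTaylor2001]

Mathlib: `CuspForm.translate`, `UpperHalfPlane.hasStrictDerivAt_smul`, `ModularForm.slash_apply`;
tree: `exists_hasDerivAt_primitive`, `segmentIntegral_eq_sub` (`ShimuraCurveDegreeFormulaProofs`),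
`exists_conj_of_discr_one`, `conjAct_inv_smul_Gamma_eq_of_conj`, `heckeFun_eq_sum_of_conj`,
`heckeFun_eq_mul_of_conj`, `card_orbitFibre_eq_of_conj` (`ShimuraParametrizationSplitCaseProofs`),
`exists_cuspForm_gamma0_coe_eq_slash`, `coe_heckeT_eq_smul_of_heckeFun_eq`
(`ShimuraParametrizationSplitDegreeProofs`, which transports data WITH the degree via `q`-expansions
and Atkin–Lehner; the present file needs neither), `coe_heckeT_gamma0`,
`nonempty_shimuraCurveData_holds`, `LFunction_smul`, `hasGlobalMinimalModel_rat_holds`.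
-/

noncomputable section

open scoped MatrixGroups ModularForm Pointwise
open UpperHalfPlane ConjAct Matrix.SpecialLinearGroup CongruenceSubgroup

namespace Literature.NumberTheory.Automorphic

open Literature.NumberTheory.EllipticCurves.ModularForms
  (intGL heckeRep HeckeIdx det_heckeRep det_heckeRep_ne_zero heckeT coe_heckeT_gamma0
    finset_sum_slash Y0 Y0.mk IsNeronLatticeOf)

/-! ### Transport of weight-two forms along `g ∈ GL₂⁺(ℝ)`: segment integrals and periods -/

section SlashTransport

variable {Γ : Subgroup (GL (Fin 2) ℝ)}

/-- **Chain rule for a primitive.** If `G` is a holomorphic primitive of the weight-`2` form `F` on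
`ℍ` and `det g > 0`, then `w ↦ G(g w)` is a primitive of `F ∣[2] g`
(`d(g w)/dw = det g / j(g, w)²`, Mathlib `UpperHalfPlane.hasStrictDerivAt_smul`). [folklore] -/
theorem hasDerivAt_comp_smul_of_hasDerivAt (F : CuspForm Γ 2) {g : GL (Fin 2) ℝ}
    (hg : 0 < g.det.val) {G : ℂ → ℂ}
    (hG : ∀ z : ℂ, 0 < z.im → HasDerivAt G (F (ofComplex z)) z) {z : ℂ} (hz : 0 < z.im) :
    HasDerivAt (fun w : ℂ => G ((g • ofComplex w : ℍ) : ℂ))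
      ((⇑F ∣[(2 : ℤ)] g) (ofComplex z)) z := by
  have hg' : 0 < g.val.det := by rwa [← Matrix.GeneralLinearGroup.val_det_apply]
  set τ : ℍ := ofComplex z with hτdef
  have hτ : (τ : ℂ) = z := by rw [hτdef, ofComplex_apply_of_im_pos hz]
  rw [← hτ]
  have h1 : HasDerivAt (fun w : ℂ => ((g • ofComplex w : ℍ) : ℂ))
      ((g.val.det : ℂ) / denom g τ ^ 2) τ :=
    (UpperHalfPlane.hasStrictDerivAt_smul hg' τ).hasDerivAt
  have h2 : HasDerivAt G (F (ofComplex ((g • ofComplex (τ : ℂ) : ℍ) : ℂ)))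
      ((g • ofComplex (τ : ℂ) : ℍ) : ℂ) :=
    hG _ (g • ofComplex (τ : ℂ)).im_pos
  have h3 := h2.comp (τ : ℂ) h1
  simp only [ofComplex_apply] at h3
  refine h3.congr_deriv ?_
  rw [ModularForm.slash_apply, σ_apply_of_det_pos hg, abs_of_pos hg,
    Matrix.GeneralLinearGroup.val_det_apply]
  have hd : denom g τ ≠ 0 := denom_ne_zero g τ
  rw [show (2 : ℤ) - 1 = 1 by norm_num, zpow_one, zpow_neg, zpow_two]
  field_simp

/-- **`∫_z^w (F ∣[2] g) = ∫_{g z}^{g w} F`** for a weight-`2` form `F` on `ℍ` and `det g > 0`: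
both sides are `G(g w) − G(g z)` for a holomorphic primitive `G` of `F`
(`exists_hasDerivAt_primitive`, `segmentIntegral_eq_sub`; the left-hand side through the cusp
form `F ∣[2] g` on `g⁻¹ Γ g`, Mathlib `CuspForm.translate`). The substitution `u = g τ`,
`F(u) du = (F ∣[2] g)(τ) dτ`. [folklore] -/
theorem segmentIntegral_slash_eq (F : CuspForm Γ 2) {g : GL (Fin 2) ℝ} (hg : 0 < g.det.val)
    (z w : ℍ) : segmentIntegral (⇑F ∣[(2 : ℤ)] g) z w = segmentIntegral F (g • z) (g • w) := by
  obtain ⟨G, hG⟩ := exists_hasDerivAt_primitive F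
  have hG' : ∀ u : ℂ, 0 < u.im →
      HasDerivAt (fun v : ℂ => G ((g • ofComplex v : ℍ) : ℂ))
        ((CuspForm.translate F g) (ofComplex u)) u :=
    fun u hu => hasDerivAt_comp_smul_of_hasDerivAt F hg hG hu
  have h1 : segmentIntegral (⇑F ∣[(2 : ℤ)] g) z w =
      G ((g • ofComplex (w : ℂ) : ℍ) : ℂ) - G ((g • ofComplex (z : ℂ) : ℍ) : ℂ) :=
    segmentIntegral_eq_sub (CuspForm.translate F g) hG' z w
  rw [segmentIntegral_eq_sub F hG (g • z) (g • w), h1]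
  simp only [ofComplex_apply]

/-- **Periods transport along conjugation**: if the periods of `F` on `Γ` lie in `Λ` and
`det g > 0`, the periods of `F ∣[2] g` on `g⁻¹ Γ g` lie in `Λ`
(`∫_z^{γ' z} (F ∣[2] g) = ∫_{g z}^{(g γ' g⁻¹)(g z)} F`). [folklore] -/
theorem hasPeriodsIn_slash (F : CuspForm Γ 2) {g : GL (Fin 2) ℝ} (hg : 0 < g.det.val)
    {Λ : Set ℂ} (hF : HasPeriodsIn Γ F Λ) :
    HasPeriodsIn (toConjAct g⁻¹ • Γ) (⇑F ∣[(2 : ℤ)] g) Λ := by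
  intro γ hγ z
  rw [mem_conjAct_inv_smul_iff] at hγ
  rw [segmentIntegral_slash_eq F hg]
  have e : g • γ • z = (g * γ * g⁻¹) • (g • z) := by
    simp only [mul_smul, inv_smul_smul]
  rw [e]
  exact hF _ hγ _

end SlashTransport

/-! ### The `D = 1` converse transport `Γ₀^1(M) → Γ₀(M)`: forms, Hecke operators, fibres -/

section ConverseTransport

variable {M : ℕ}

variable (X : ShimuraCurveData 1 M) {h : GL (Fin 2) ℝ}
  (H : ∀ m : Matrix (Fin 2) (Fin 2) ℝ, (∃ x ∈ X.O, X.ι x = m) ↔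
    ∃ A : Matrix (Fin 2) (Fin 2) ℤ, (M : ℤ) ∣ A 1 0 ∧
      m = (h : Matrix (Fin 2) (Fin 2) ℝ) * A.map (Int.cast : ℤ → ℝ) *
        ((h⁻¹ : GL (Fin 2) ℝ) : Matrix (Fin 2) (Fin 2) ℝ))

include H in
/-- **The unconditional Hecke identity.** If `Γ₀^1(M) = h Γ₀(M) h⁻¹` (`det h > 0`) and
`F = C · (f ∣[2] h⁻¹)` for `f ∈ S₂(Γ₀(M))`, then for every prime `ℓ ∤ M`,
`X.heckeFun ℓ F = C · (T_ℓ f) ∣[2] h⁻¹`: both are sums over the `ℓ + 1` cosets `h βᵢ h⁻¹`,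
resp. `βᵢ` (Diamond–Shurman Prop. 5.2.1; Pasten §4.8 for `T_{U,n}`; the computation inside the
tree's `heckeFun_eq_mul_of_conj`, isolated). [cite: DiamondShurman2005, Prop. 5.2.1] [cite: PastenShimura2024, §4.8 p. 15 (Hecke action)] -/
theorem ShimuraCurveData.heckeFun_eq_smul_heckeT_slash [NeZero M] (hdet : 0 < h.det.val)
    (hΓ : toConjAct h⁻¹ • X.Gamma = (Gamma0 M).map (mapGL ℝ))
    (f : CuspForm (Gamma0 M) 2) (C : ℂ) (F : CuspForm X.Gamma 2)
    (hF : (⇑F : ℍ → ℂ) = C • (⇑f ∣[(2 : ℤ)] h⁻¹)) {ℓ : ℕ} (hℓ : ℓ.Prime) (hℓM : ¬ ℓ ∣ M) :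
    X.heckeFun ℓ F =
      C • ((⇑(haveI : NeZero ℓ := ⟨hℓ.ne_zero⟩; heckeT (Gamma0 M) 2 ℓ f) : ℍ → ℂ) ∣[(2 : ℤ)] h⁻¹) := by
  haveI : NeZero ℓ := ⟨hℓ.ne_zero⟩
  have hdet' : 0 < (h⁻¹).det.val := by
    rw [map_inv, Units.val_inv_eq_inv_val]
    exact inv_pos.mpr hdet
  funext τ
  rw [X.heckeFun_eq_sum_of_conj H hΓ hℓ hℓM F τ]
  have hterm : ∀ i : HeckeIdx M ℓ, ⇑F ∣[(2 : ℤ)] (h * intGL (heckeRep ℓ i.1) * h⁻¹) =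
      C • ((⇑f ∣[(2 : ℤ)] intGL (heckeRep ℓ i.1)) ∣[(2 : ℤ)] h⁻¹) := by
    intro i
    have hβ : 0 < (intGL (heckeRep ℓ i.1) : GL (Fin 2) ℝ).det.val := by
      rw [det_intGL_val (det_heckeRep_ne_zero hℓ.ne_zero _), det_heckeRep]
      exact_mod_cast hℓ.pos
    have hfh : (⇑f ∣[(2 : ℤ)] h⁻¹) ∣[(2 : ℤ)] h = ⇑f := by
      rw [← SlashAction.slash_mul, inv_mul_cancel, SlashAction.slash_one]
    rw [SlashAction.slash_mul, SlashAction.slash_mul, hF, smul_slash_of_det_pos hdet, hfh,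
      smul_slash_of_det_pos hβ, smul_slash_of_det_pos hdet']
  simp only [hterm]
  rw [← Finset.smul_sum, ← finset_sum_slash, ← coe_heckeT_gamma0 M 2 ℓ hℓ f]

/-- **Fibre counts transport back to `Y₀(M)`.** For `F` on `Γ₀^1(M) = h Γ₀(M) h⁻¹` (`det h > 0`)
and `f = F ∣[2] h`, the number of `Γ₀(M)`-orbits `Γ₀(M)τ' ∈ Y₀(M)` with
`q(∫_{h⁻¹ τ₀}^{τ'} f) = P` equals the number of `Γ₀^1(M)`-orbits `Γ₀^1(M)τ` with
`q(∫_{τ₀}^{τ} F) = P` (`τ = h τ'`, `∫_{h⁻¹τ₀}^{τ'} (F ∣[2] h) = ∫_{τ₀}^{h τ'} F`), for any map `q`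
on `ℂ` and every `P`; so the exceptional sets `{P | # fibre ≠ d}` coincide. [folklore] -/
theorem ShimuraCurveData.finite_setOf_card_orbitFibre_gamma0_ne (hdet : 0 < h.det.val)
    (hΓ : toConjAct h⁻¹ • X.Gamma = (Gamma0 M).map (mapGL ℝ)) (F : CuspForm X.Gamma 2)
    {A : Type*} (q : ℂ → A) (τ₀ : ℍ) (d : ℕ)
    (hfin : {P : A | Nat.card {y : MulAction.orbitRel.Quotient X.Gamma ℍ // ∃ τ : ℍ,
        (Quotient.mk _ τ : MulAction.orbitRel.Quotient X.Gamma ℍ) = y ∧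
          q (segmentIntegral F τ₀ τ) = P} ≠ d}.Finite) :
    {P : A | Nat.card {y : Y0 M // ∃ τ : ℍ, Y0.mk M τ = y ∧
        q (segmentIntegral (⇑F ∣[(2 : ℤ)] h) (h⁻¹ • τ₀) τ) = P} ≠ d}.Finite := by
  have hG : ∀ τ : ℍ, q (segmentIntegral F τ₀ τ) =
      q (segmentIntegral (⇑F ∣[(2 : ℤ)] h) (h⁻¹ • τ₀) (h⁻¹ • τ)) := fun τ => by
    rw [segmentIntegral_slash_eq F hdet, smul_inv_smul, smul_inv_smul]
  convert hfin using 3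
  rw [X.card_orbitFibre_eq_of_conj hΓ
    (fun τ => q (segmentIntegral (⇑F ∣[(2 : ℤ)] h) (h⁻¹ • τ₀) τ))
    (fun τ => q (segmentIntegral F τ₀ τ)) hG]

end ConverseTransport

/-! ### At `D = 1` the automorphic half on `Γ₀^1(M)` and the classical half on `Γ₀(M)` are equivalent -/

section Halves

variable {M : ℕ}

/-- **Classical half from the automorphic half (`D = 1`).** Let `X` be a Shimura curve datum of
level `(1, M)`, so that `Γ₀^1(M) = h Γ₀(M) h⁻¹` with `det h > 0` (`exists_conj_of_discr_one`,
`conjAct_inv_smul_Gamma_eq_of_conj`). If `F ∈ S₂(Γ₀^1(M))` has periods in `Λ`, satisfies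
`T_ℓ F = a_ℓ F` (`X.heckeFun`) for the primes `ℓ ∤ M`, and `Γ₀^1(M)τ ↦ ∫_{τ₀}^τ F (mod Λ)` has
exactly `d` preimage orbits over all but finitely many classes, then `f = F ∣[2] h ∈ S₂(Γ₀(M))`
has periods in `Λ` (`hasPeriodsIn_slash`), satisfies `T_ℓ f = a_ℓ f` for the classical `T_ℓ`
(`coe_heckeT_eq_smul_of_heckeFun_eq`), and `Γ₀(M)τ' ↦ ∫_{h⁻¹τ₀}^{τ'} f (mod Λ)` has the same
fibre count on `Y₀(M)` (`finite_setOf_card_orbitFibre_gamma0_ne`); `f ≠ 0` if `F ≠ 0`. This is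
Pasten's "`X₀^1(N) = X₀(N)`" (§2 p. 12) read backwards, for an arbitrary presentation
`(B, O, ι)` and arbitrary eigen-data. [cite: PastenShimura2024, §2 p. 12 and §5.3 p. 17] [cite: DiamondShurman2005, Prop. 5.2.1] -/
theorem classicalHalf_of_automorphicHalf_one [NeZero M] (X : ShimuraCurveData 1 M)
    {Λ : AddSubgroup ℂ} {a : ℕ → ℂ} {F : CuspForm X.Gamma 2} {τ₀ : ℍ} {d : ℕ}
    (hper : HasPeriodsIn X.Gamma F (Λ : Set ℂ))
    (hhecke : ∀ ℓ : ℕ, ℓ.Prime → ¬ ℓ ∣ M → X.heckeFun ℓ F = fun τ => a ℓ * F τ)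
    (hfin : {P : ℂ ⧸ Λ | Nat.card {y : MulAction.orbitRel.Quotient X.Gamma ℍ // ∃ τ : ℍ,
        (Quotient.mk _ τ : MulAction.orbitRel.Quotient X.Gamma ℍ) = y ∧
          ((segmentIntegral F τ₀ τ : ℂ) : ℂ ⧸ Λ) = P} ≠ d}.Finite) :
    ∃ (f : CuspForm (Gamma0 M) 2) (τ₀' : ℍ),
      ((⇑F : ℍ → ℂ) ≠ 0 → (⇑f : ℍ → ℂ) ≠ 0) ∧
      HasPeriodsIn ((Gamma0 M).map (mapGL ℝ)) f (Λ : Set ℂ) ∧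
      (∀ (ℓ : ℕ) [NeZero ℓ], ℓ.Prime → ¬ ℓ ∣ M →
        (⇑(heckeT (Gamma0 M) 2 ℓ f) : ℍ → ℂ) = a ℓ • ⇑f) ∧
      {P : ℂ ⧸ Λ | Nat.card {y : Y0 M // ∃ τ : ℍ, Y0.mk M τ = y ∧
          ((segmentIntegral f τ₀' τ : ℂ) : ℂ ⧸ Λ) = P} ≠ d}.Finite := by
  obtain ⟨-, h, hdet, H⟩ := X.exists_conj_of_discr_one
  have hΓ := X.conjAct_inv_smul_Gamma_eq_of_conj H
  obtain ⟨f, hf⟩ := X.exists_cuspForm_gamma0_coe_eq_slash hΓ F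
  refine ⟨f, h⁻¹ • τ₀, fun hF0 hf0 => hF0 ?_, ?_, fun ℓ _ hℓ hℓM => ?_, ?_⟩
  · -- `F = (F ∣ h) ∣ h⁻¹ = f ∣ h⁻¹ = 0`
    have e : (⇑F : ℍ → ℂ) = (⇑f : ℍ → ℂ) ∣[(2 : ℤ)] h⁻¹ := by
      rw [hf, ← SlashAction.slash_mul, mul_inv_cancel, SlashAction.slash_one]
    rw [e, hf0, SlashAction.zero_slash]
  · rw [hf, ← hΓ]
    exact hasPeriodsIn_slash F hdet hper
  · exact X.coe_heckeT_eq_smul_of_heckeFun_eq H hdet hΓ F f hf hℓ hℓM (hhecke ℓ hℓ hℓM)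
  · have key := X.finite_setOf_card_orbitFibre_gamma0_ne hdet hΓ F
      (fun z : ℂ => ((z : ℂ) : ℂ ⧸ Λ)) τ₀ d hfin
    simpa only [hf] using key

/-- **Automorphic half from the classical half (`D = 1`)** — the converse transport, generalising
the tree's `automorphicHalf_one_of_isNewformOf` from the newform of `W` to arbitrary eigen-data:
with `Γ₀^1(M) = h Γ₀(M) h⁻¹` (`det h > 0`), `f ∈ S₂(Γ₀(M))` with periods in `Λ`, `T_ℓ f = a_ℓ f`
(`ℓ ∤ M` prime) and fibre count `d` on `Y₀(M)` gives `F = f ∣[2] h⁻¹ ∈ S₂(Γ₀^1(M))`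
(`exists_cuspForm_coe_eq_smul_slash`) with periods in `Λ`, `T_ℓ F = a_ℓ F` for `X.heckeFun`
(`heckeFun_eq_mul_of_conj`) and the same fibre count on `Γ₀^1(M)∖ℍ`
(`finite_setOf_card_orbitFibre_ne_of_conj`); `F ≠ 0` if `f ≠ 0`. [cite: PastenShimura2024, §2 p. 12 and §5.3 p. 17] [cite: DiamondShurman2005, Prop. 5.2.1] -/
theorem automorphicHalf_one_of_classicalHalf [NeZero M] (X : ShimuraCurveData 1 M)
    {Λ : AddSubgroup ℂ} {a : ℕ → ℂ} {f : CuspForm (Gamma0 M) 2} {τ₀ : ℍ} {d : ℕ}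
    (hper : HasPeriodsIn ((Gamma0 M).map (mapGL ℝ)) f (Λ : Set ℂ))
    (hhecke : ∀ (ℓ : ℕ) [NeZero ℓ], ℓ.Prime → ¬ ℓ ∣ M →
      (⇑(heckeT (Gamma0 M) 2 ℓ f) : ℍ → ℂ) = a ℓ • ⇑f)
    (hfin : {P : ℂ ⧸ Λ | Nat.card {y : Y0 M // ∃ τ : ℍ, Y0.mk M τ = y ∧
        ((segmentIntegral f τ₀ τ : ℂ) : ℂ ⧸ Λ) = P} ≠ d}.Finite) :
    ∃ (F : CuspForm X.Gamma 2) (τ₀' : ℍ),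
      ((⇑f : ℍ → ℂ) ≠ 0 → (⇑F : ℍ → ℂ) ≠ 0) ∧
      HasPeriodsIn X.Gamma F (Λ : Set ℂ) ∧
      (∀ ℓ : ℕ, ℓ.Prime → ¬ ℓ ∣ M → X.heckeFun ℓ F = fun τ => a ℓ * F τ) ∧
      {P : ℂ ⧸ Λ | Nat.card {y : MulAction.orbitRel.Quotient X.Gamma ℍ // ∃ τ : ℍ,
          (Quotient.mk _ τ : MulAction.orbitRel.Quotient X.Gamma ℍ) = y ∧
            ((segmentIntegral F τ₀' τ : ℂ) : ℂ ⧸ Λ) = P} ≠ d}.Finite := by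
  obtain ⟨-, h, hdet, H⟩ := X.exists_conj_of_discr_one
  have hΓ := X.conjAct_inv_smul_Gamma_eq_of_conj H
  have hdet' : 0 < (h⁻¹).det.val := by
    rw [map_inv, Units.val_inv_eq_inv_val]
    exact inv_pos.mpr hdet
  obtain ⟨F, hF1⟩ := X.exists_cuspForm_coe_eq_smul_slash hΓ f 1
  have hF : (⇑F : ℍ → ℂ) = (⇑f : ℍ → ℂ) ∣[(2 : ℤ)] h⁻¹ := by rw [hF1, one_smul]
  refine ⟨F, h • τ₀, fun hf0 hF0 => hf0 ?_, ?_, fun ℓ hℓ hℓM => ?_, ?_⟩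
  · have e : (⇑f : ℍ → ℂ) = (⇑F : ℍ → ℂ) ∣[(2 : ℤ)] h := by
      rw [hF, ← SlashAction.slash_mul, inv_mul_cancel, SlashAction.slash_one]
    rw [e, hF0, SlashAction.zero_slash]
  · have hΓ' : toConjAct h⁻¹⁻¹ • ((Gamma0 M).map (mapGL ℝ)) = X.Gamma := by
      rw [← hΓ, smul_smul, ← map_mul, inv_inv, mul_inv_cancel, map_one, one_smul]
    rw [hF, ← hΓ']
    exact hasPeriodsIn_slash f hdet' hper
  · haveI : NeZero ℓ := ⟨hℓ.ne_zero⟩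
    exact X.heckeFun_eq_mul_of_conj H hdet hΓ f 1 F hF1 hℓ hℓM (hhecke ℓ hℓ hℓM)
  · refine X.finite_setOf_card_orbitFibre_ne_of_conj hΓ
      (fun τ : ℍ => ((segmentIntegral f τ₀ τ : ℂ) : ℂ ⧸ Λ))
      (fun τ : ℍ => ((segmentIntegral F (h • τ₀) τ : ℂ) : ℂ ⧸ Λ)) (fun τ => ?_) d hfin
    simp only [hF]
    rw [segmentIntegral_slash_eq f hdet', inv_smul_smul]

/-- **The two halves are equivalent at `D = 1`.** For a datum `X` of level `(1, M)`, a subgroup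
`Λ ⊆ ℂ`, eigenvalues `(a_ℓ)` and `d`: there is a NON-ZERO `F ∈ S₂(Γ₀^1(M))` with periods in `Λ`,
`T_ℓ F = a_ℓ F` (`ℓ ∤ M`) and fibre count `d` off a finite set of `ℂ/Λ` iff there is a non-zero
`f ∈ S₂(Γ₀(M))` with periods in `Λ`, `T_ℓ f = a_ℓ f` for the classical Hecke operators and fibre
count `d` on `Y₀(M)` off a finite set (`classicalHalf_of_automorphicHalf_one`,
`automorphicHalf_one_of_classicalHalf`). [cite: PastenShimura2024, §2 p. 12 ("X₀^1(N) = X₀(N)")] -/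
theorem exists_automorphicHalf_one_iff_classicalHalf [NeZero M] (X : ShimuraCurveData 1 M)
    (Λ : AddSubgroup ℂ) (a : ℕ → ℂ) (d : ℕ) :
    (∃ (F : CuspForm X.Gamma 2) (τ₀ : ℍ), (⇑F : ℍ → ℂ) ≠ 0 ∧
        HasPeriodsIn X.Gamma F (Λ : Set ℂ) ∧
        (∀ ℓ : ℕ, ℓ.Prime → ¬ ℓ ∣ M → X.heckeFun ℓ F = fun τ => a ℓ * F τ) ∧
        {P : ℂ ⧸ Λ | Nat.card {y : MulAction.orbitRel.Quotient X.Gamma ℍ // ∃ τ : ℍ,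
            (Quotient.mk _ τ : MulAction.orbitRel.Quotient X.Gamma ℍ) = y ∧
              ((segmentIntegral F τ₀ τ : ℂ) : ℂ ⧸ Λ) = P} ≠ d}.Finite) ↔
    (∃ (f : CuspForm (Gamma0 M) 2) (τ₀ : ℍ), (⇑f : ℍ → ℂ) ≠ 0 ∧
        HasPeriodsIn ((Gamma0 M).map (mapGL ℝ)) f (Λ : Set ℂ) ∧
        (∀ (ℓ : ℕ) [NeZero ℓ], ℓ.Prime → ¬ ℓ ∣ M →
          (⇑(heckeT (Gamma0 M) 2 ℓ f) : ℍ → ℂ) = a ℓ • ⇑f) ∧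
        {P : ℂ ⧸ Λ | Nat.card {y : Y0 M // ∃ τ : ℍ, Y0.mk M τ = y ∧
            ((segmentIntegral f τ₀ τ : ℂ) : ℂ ⧸ Λ) = P} ≠ d}.Finite) := by
  constructor
  · rintro ⟨F, τ₀, hF0, hper, hhecke, hfin⟩
    obtain ⟨f, τ₀', hf0, hper', hhecke', hfin'⟩ :=
      classicalHalf_of_automorphicHalf_one X hper hhecke hfin
    exact ⟨f, τ₀', hf0 hF0, hper', hhecke', hfin'⟩
  · rintro ⟨f, τ₀, hf0, hper, hhecke, hfin⟩
    obtain ⟨F, τ₀', hF0, hper', hhecke', hfin'⟩ :=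
      automorphicHalf_one_of_classicalHalf X hper hhecke hfin
    exact ⟨F, τ₀', hF0 hf0, hper', hhecke', hfin'⟩

end Halves

/-! ### What the named fact implies: analytic modular parametrisations by `Y₀(N)` -/

section FromTheFact

open Literature.NumberTheory.EllipticCurves.ModularForms
  (exists_isNeronLatticeOf_holds exists_isNewformOf)

/-- **The degree clause of a datum on `ℂ/Λ_L`, for every Néron-type `L`** (the field `deg_spec`
of `P`, transported back along `QuotientAddGroup.liftEquiv : ℂ/Λ_L ≃+ W(ℂ)` induced by
`P.uniformize`; the computation inside `ShimuraParametrizationData.automorphicHalf`, keeping the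
form `P.form`, the base point and the degree of `P`). [folklore] -/
theorem ShimuraParametrizationData.finite_setOf_card_orbitFibre_form_ne {D M : ℕ}
    {X : ShimuraCurveData D M} {W : WeierstrassCurve ℚ} (P : ShimuraParametrizationData X W)
    {L : PeriodPair} (hL : IsNeronLatticeOf (W.baseChange ℂ) L) :
    {c : ℂ ⧸ L.lattice.toAddSubgroup |
      Nat.card {y : MulAction.orbitRel.Quotient X.Gamma ℍ // ∃ τ : ℍ,
        (Quotient.mk _ τ : MulAction.orbitRel.Quotient X.Gamma ℍ) = y ∧
          ((segmentIntegral P.form P.basePoint τ : ℂ) : ℂ ⧸ L.lattice.toAddSubgroup) = c} ≠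
        P.deg}.Finite := by
  have hLL : L.lattice = P.L.lattice := P.lattice_eq_of_isNeronLatticeOf hL
  have hker' : L.lattice.toAddSubgroup = P.uniformize.ker :=
    SetLike.coe_injective (by rw [Submodule.coe_toAddSubgroup, hLL, P.ker_uniformize])
  let e : ℂ ⧸ L.lattice.toAddSubgroup ≃+ (W.baseChange ℂ).toAffine.Point :=
    QuotientAddGroup.liftEquiv L.lattice.toAddSubgroup P.uniformize_surjective hker'
  have he : ∀ x : ℂ, e.toEquiv (x : ℂ ⧸ L.lattice.toAddSubgroup) = P.uniformize x := fun _ => rfl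
  refine (finite_setOf_card_orbitFibre_ne_iff
    (fun τ : ℍ => (Quotient.mk _ τ : MulAction.orbitRel.Quotient X.Gamma ℍ)) e.toEquiv
    (fun τ : ℍ => ((segmentIntegral P.form P.basePoint τ : ℂ) : ℂ ⧸ L.lattice.toAddSubgroup))
    P.deg).mp ?_
  simp only [he]
  exact P.deg_spec

/-- **`nonempty_shimuraParametrizationData` implies an analytic modular parametrisation by
`Y₀(N)` of every globally minimal elliptic curve over `ℚ`.** If the fact holds, then for every
globally minimal elliptic `W/ℚ` of conductor `N` and every Néron-type period pair `L` of `W` there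
are `f ≠ 0` in `S₂(Γ₀(N))`, a base point `τ₀` and `d ≥ 1` such that: the periods of `f` on `Γ₀(N)`
lie in `Λ_L`; `T_ℓ f = a_ℓ(W) f` for every prime `ℓ ∤ N` (classical `T_ℓ`, Mathlib
`WeierstrassCurve.LFunction`); and all but finitely many classes of `ℂ/Λ_L (≅ W(ℂ))` have exactly
`d` preimage orbits `Γ₀(N)τ ∈ Y₀(N)` under `τ ↦ ∫_{τ₀}^τ f` — i.e. `τ ↦ ∫_{τ₀}^τ f (mod Λ_L)` is a
non-constant holomorphic map `Y₀(N) → W(ℂ)` of degree `d` whose pull-back of `du` is a Hecke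
eigenform with the eigenvalues of `W` away from `N`. Proof: a datum `X` of level `(1, N)` exists
(`nonempty_shimuraCurveData_holds`), the fact gives `P : ShimuraParametrizationData X W`
(`P.form ≠ 0`, `coe_form_ne_zero`), and `classicalHalf_of_automorphicHalf_one` transports it to
`Γ₀(N)`. This is the `D = 1` content of Pasten §2 p. 12 ("the Eichler–Shimura construction gives
… `φ = q_{1,N} j_N : X₀(N) → A_{1,N}`", `A_{1,N} ∼ E`), i.e. the modularity of `W` in the analytic
form "a non-constant map `X₀(N) → E` over `ℂ`" (Breuil–Conrad–Diamond–Taylor 2001, Thm. A, one of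
the equivalent forms of "`E` is modular"). [cite: PastenShimura2024, §2 p. 12] [cite: BreuilConradDiamondTaylor2001, Thm. A] -/
theorem classicalHalf_of_nonempty_shimuraParametrizationData
    (hP : nonempty_shimuraParametrizationData) {N : ℕ} [NeZero N] (W : WeierstrassCurve ℚ)
    [W.IsElliptic] [W.IsGloballyMinimal] (hN : W.conductorNorm ℤ = N) {L : PeriodPair}
    (hL : IsNeronLatticeOf (W.baseChange ℂ) L) :
    ∃ (f : CuspForm (Gamma0 N) 2) (τ₀ : ℍ) (d : ℕ), (⇑f : ℍ → ℂ) ≠ 0 ∧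
      HasPeriodsIn ((Gamma0 N).map (mapGL ℝ)) f (L.lattice : Set ℂ) ∧
      (∀ (ℓ : ℕ) [NeZero ℓ], ℓ.Prime → ¬ ℓ ∣ N →
        (⇑(heckeT (Gamma0 N) 2 ℓ f) : ℍ → ℂ) = ((W.LFunction ℓ : ℤ) : ℂ) • ⇑f) ∧
      0 < d ∧
      {c : ℂ ⧸ L.lattice.toAddSubgroup | Nat.card {y : Y0 N // ∃ τ : ℍ, Y0.mk N τ = y ∧
          ((segmentIntegral f τ₀ τ : ℂ) : ℂ ⧸ L.lattice.toAddSubgroup) = c} ≠ d}.Finite := by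
  have hadm : IsAdmissibleFactorization N 1 N :=
    isAdmissibleFactorization_one (Nat.pos_of_ne_zero (NeZero.ne N))
  obtain ⟨X⟩ := nonempty_shimuraCurveData_holds hadm
  obtain ⟨P⟩ := hP hadm X W hN
  have hLL : L.lattice = P.L.lattice := P.lattice_eq_of_isNeronLatticeOf hL
  have hper : HasPeriodsIn X.Gamma P.form (L.lattice.toAddSubgroup : Set ℂ) := by
    rw [Submodule.coe_toAddSubgroup, hLL]
    exact P.period_mem
  have hhecke : ∀ ℓ : ℕ, ℓ.Prime → ¬ ℓ ∣ N →
      X.heckeFun ℓ P.form = fun τ => ((W.LFunction ℓ : ℤ) : ℂ) * P.form τ :=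
    fun ℓ hℓ hℓN => P.hecke_eq ℓ hℓ (by rwa [one_mul])
  obtain ⟨f, τ₀', hf0, hper', hhecke', hfin'⟩ :=
    classicalHalf_of_automorphicHalf_one X (a := fun ℓ => ((W.LFunction ℓ : ℤ) : ℂ))
      hper hhecke (P.finite_setOf_card_orbitFibre_form_ne hL)
  refine ⟨f, τ₀', P.deg, hf0 P.coe_form_ne_zero, ?_, hhecke', P.deg_pos, hfin'⟩
  simpa only [Submodule.coe_toAddSubgroup] using hper'

/-- **`nonempty_shimuraParametrizationData` implies that every elliptic curve over `ℚ` is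
almost-everywhere modular**: for every elliptic `W/ℚ` of conductor `N` there is a NON-ZERO
`f ∈ S₂(Γ₀(N))` with `T_ℓ f = a_ℓ(W) f` for every prime `ℓ ∤ N`
(`classicalHalf_of_nonempty_shimuraParametrizationData` for a global minimal model `C • W`, which
has the same conductor and the same `L`-coefficients: tree `hasGlobalMinimalModel_rat_holds`,
`conductorNorm_smul_rat`, `LFunction_smul`). So the named fact is at least as strong as the
Modularity theorem in its "`a_p` for almost all `p`" form (Breuil–Conrad–Diamond–Taylor 2001,
Thm. A; Diamond–Shurman Thm. 8.8.1), of which the tree's root fact `exists_isNewformOf` is the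
newform version. [cite: BreuilConradDiamondTaylor2001, Thm. A] [cite: PastenShimura2024, §2 p. 12] -/
theorem exists_heckeEigenform_of_nonempty_shimuraParametrizationData
    (hP : nonempty_shimuraParametrizationData) (W : WeierstrassCurve ℚ) [W.IsElliptic]
    {N : ℕ} [NeZero N] (hN : W.conductorNorm ℤ = N) :
    ∃ f : CuspForm (Gamma0 N) 2, (⇑f : ℍ → ℂ) ≠ 0 ∧
      ∀ (ℓ : ℕ) [NeZero ℓ], ℓ.Prime → ¬ ℓ ∣ N →
        (⇑(heckeT (Gamma0 N) 2 ℓ f) : ℍ → ℂ) = ((W.LFunction ℓ : ℤ) : ℂ) • ⇑f := by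
  obtain ⟨C₀, hC₀⟩ := WeierstrassCurve.hasGlobalMinimalModel_rat_holds W
  haveI := hC₀
  have hN' : (C₀ • W).conductorNorm ℤ = N := by
    rw [WeierstrassCurve.conductorNorm_smul_rat W C₀, hN]
  haveI : ((C₀ • W).baseChange ℂ).IsElliptic := by
    rw [WeierstrassCurve.baseChange]
    infer_instance
  obtain ⟨L, hL⟩ := exists_isNeronLatticeOf_holds ((C₀ • W).baseChange ℂ)
  obtain ⟨f, -, -, hf0, -, hhecke, -, -⟩ :=
    classicalHalf_of_nonempty_shimuraParametrizationData hP (C₀ • W) hN' hL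
  refine ⟨f, hf0, fun ℓ _ hℓ hℓN => ?_⟩
  rw [hhecke ℓ hℓ hℓN, WeierstrassCurve.LFunction_smul]

/-- **Characterisation of the named fact.** `nonempty_shimuraParametrizationData` holds iff
(i) every globally minimal elliptic `W/ℚ` has, for every Néron-type `L`, an analytic modular
parametrisation by `Y₀(N_W)` in the sense of `classicalHalf_of_nonempty_shimuraParametrizationData`
(a non-zero `f ∈ S₂(Γ₀(N_W))` with periods in `Λ_L`, `T_ℓ f = a_ℓ(W) f` for `ℓ ∤ N_W`, and a
cofinite fibre count `d ≥ 1`), AND (ii) for every admissible `N = D M` with `D > 1`, every datum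
`X` of level `(D, M)`, every globally minimal elliptic `W/ℚ` of conductor `N` and every Néron-type
`L`, a non-zero `h ∈ S₂(Γ₀^D(M))` with periods in `Λ_L` and `T_ℓ h = a_ℓ(W) h` (`ℓ ∤ D M`) — the
Jacquet–Langlands eigenform with Néron periods (Pasten §2 p. 12, §4.10–4.11). `→`: (i) is
`classicalHalf_of_nonempty_shimuraParametrizationData`, (ii) is read off the datum
(`coe_form_ne_zero`, `period_mem`, `hecke_eq`); `←`: the tree's
`nonempty_shimuraParametrizationData_of_one_and_eigenform`, its `D = 1` hypothesis supplied from
(i) by `automorphicHalf_one_of_classicalHalf` (the degree clause at `D > 1` being the tree's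
theorem `ShimuraCurveData.exists_deg_of_hasPeriodsIn`). So the fact is exactly "analytic
modularity of all `E/ℚ` by `X₀(N)`" plus its quaternionic twin for `D > 1`.
[cite: PastenShimura2024, §2 p. 12 and §4.10–4.11 p. 16 and Prop. 5.1 p. 17] [cite: BreuilConradDiamondTaylor2001, Thm. A] -/
theorem nonempty_shimuraParametrizationData_iff_classicalHalf_and_eigenform :
    nonempty_shimuraParametrizationData ↔
    ((∀ (W : WeierstrassCurve ℚ) [W.IsElliptic] [W.IsGloballyMinimal]
        [NeZero (W.conductorNorm ℤ)] {L : PeriodPair}, IsNeronLatticeOf (W.baseChange ℂ) L →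
        ∃ (f : CuspForm (Gamma0 (W.conductorNorm ℤ)) 2) (τ₀ : ℍ) (d : ℕ), (⇑f : ℍ → ℂ) ≠ 0 ∧
          HasPeriodsIn ((Gamma0 (W.conductorNorm ℤ)).map (mapGL ℝ)) f (L.lattice : Set ℂ) ∧
          (∀ (ℓ : ℕ) [NeZero ℓ], ℓ.Prime → ¬ ℓ ∣ W.conductorNorm ℤ →
            (⇑(heckeT (Gamma0 (W.conductorNorm ℤ)) 2 ℓ f) : ℍ → ℂ) =
              ((W.LFunction ℓ : ℤ) : ℂ) • ⇑f) ∧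
          0 < d ∧
          {c : ℂ ⧸ L.lattice.toAddSubgroup | Nat.card {y : Y0 (W.conductorNorm ℤ) // ∃ τ : ℍ,
              Y0.mk (W.conductorNorm ℤ) τ = y ∧
                ((segmentIntegral f τ₀ τ : ℂ) : ℂ ⧸ L.lattice.toAddSubgroup) = c} ≠ d}.Finite) ∧
      (∀ {N D M : ℕ}, IsAdmissibleFactorization N D M → 1 < D →
        ∀ (X : ShimuraCurveData D M) (W : WeierstrassCurve ℚ) [W.IsElliptic]
          [W.IsGloballyMinimal], W.conductorNorm ℤ = N →
          ∀ {L : PeriodPair}, IsNeronLatticeOf (W.baseChange ℂ) L →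
          ∃ h : CuspForm X.Gamma 2, (⇑h : ℍ → ℂ) ≠ 0 ∧
            HasPeriodsIn X.Gamma h (L.lattice : Set ℂ) ∧
            ∀ ℓ : ℕ, ℓ.Prime → ¬ ℓ ∣ D * M →
              X.heckeFun ℓ h = fun τ => ((W.LFunction ℓ : ℤ) : ℂ) * h τ)) := by
  constructor
  · intro hP
    refine ⟨?_, ?_⟩
    · intro W _ _ _ L hL
      exact classicalHalf_of_nonempty_shimuraParametrizationData hP W rfl hL
    · intro N D M hNDM _ X W _ _ hN L hL
      obtain ⟨P⟩ := hP hNDM X W hN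
      have hLL : L.lattice = P.L.lattice := P.lattice_eq_of_isNeronLatticeOf hL
      exact ⟨P.form, P.coe_form_ne_zero, hLL ▸ P.period_mem, P.hecke_eq⟩
  · rintro ⟨h₁, hJL⟩
    refine nonempty_shimuraParametrizationData_of_one_and_eigenform ?_ hJL
    intro N M hNDM X W _ _ hN L hL
    have hMN : N = M := by
      have e := hNDM.mul_eq
      rw [one_mul] at e
      exact e.symm
    subst hMN
    subst hN
    haveI : NeZero (W.conductorNorm ℤ) := ⟨hNDM.pos.ne'⟩
    obtain ⟨f, τ₀, d, hf0, hper, hhecke, hd, hfin⟩ := h₁ W hL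
    obtain ⟨F, τ₀', -, hper', hhecke', hfin'⟩ :=
      automorphicHalf_one_of_classicalHalf X (Λ := L.lattice.toAddSubgroup)
        (a := fun ℓ => ((W.LFunction ℓ : ℤ) : ℂ))
        (by simpa only [Submodule.coe_toAddSubgroup] using hper) hhecke hfin
    refine ⟨F, τ₀', d, ?_, fun ℓ hℓ hℓM => hhecke' ℓ hℓ (by rwa [one_mul] at hℓM), hd, hfin'⟩
    simpa only [Submodule.coe_toAddSubgroup] using hper'

/-- **Modulo the Modularity theorem, the fact is exactly its `D > 1` Jacquet–Langlands half.**
Given `exists_isNewformOf` (Diamond–Shurman Thm. 8.8.3; BCDT 2001 Thm. A),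
`nonempty_shimuraParametrizationData` holds iff for every admissible `N = D M` with `D > 1`, every
datum `X`, every globally minimal elliptic `W/ℚ` of conductor `N` and every Néron-type `L` there is
a non-zero `h ∈ S₂(Γ₀^D(M))` with periods in `Λ_L` and `T_ℓ h = a_ℓ(W) h` (`ℓ ∤ D M`):
`←` is the tree's `nonempty_shimuraParametrizationData_of_exists_isNewformOf`, `→` reads the
eigenform off the datum. (So, once `exists_isNewformOf` lands, what remains of the fact is
precisely the Jacquet–Langlands transfer with Shimura's construction on `X₀^D(M)`, Pasten §2 p. 12
and §4.10–4.11.) [cite: PastenShimura2024, §2 p. 12 and §4.10–4.11 p. 16] [cite: DiamondShurman2005, Thm. 8.8.3] -/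
theorem nonempty_shimuraParametrizationData_iff_eigenform_of_exists_isNewformOf
    (hmod : exists_isNewformOf) :
    nonempty_shimuraParametrizationData ↔
    ∀ {N D M : ℕ}, IsAdmissibleFactorization N D M → 1 < D →
      ∀ (X : ShimuraCurveData D M) (W : WeierstrassCurve ℚ) [W.IsElliptic] [W.IsGloballyMinimal],
        W.conductorNorm ℤ = N → ∀ {L : PeriodPair}, IsNeronLatticeOf (W.baseChange ℂ) L →
        ∃ h : CuspForm X.Gamma 2, (⇑h : ℍ → ℂ) ≠ 0 ∧
          HasPeriodsIn X.Gamma h (L.lattice : Set ℂ) ∧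
          ∀ ℓ : ℕ, ℓ.Prime → ¬ ℓ ∣ D * M →
            X.heckeFun ℓ h = fun τ => ((W.LFunction ℓ : ℤ) : ℂ) * h τ :=
  ⟨fun hP => (nonempty_shimuraParametrizationData_iff_classicalHalf_and_eigenform.mp hP).2,
    nonempty_shimuraParametrizationData_of_exists_isNewformOf hmod⟩

end FromTheFact

end Literature.NumberTheory.Automorphic

end
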